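import Literature.NumberTheory.LFunctions.MertensPrimeIdeals
import Literature.NumberTheory.Sieve.BatemanHornProofs
import HarnessLib

/-!
# Mertens' first theorem for the roots of a polynomial congruence (Landau 1903)

Topic `Literature/NumberTheory/LFunctions` (next to `DegreeOnePrimesPNT.lean`, `MertensPrimeIdeals.lean`).
Everything in this file is PROVED (theorems only, no named facts).

For `g ∈ ℤ[X]` irreducible and non-constant let `ρ_g(p) = #{n mod p : g(n) ≡ 0 (mod p)}`
(`Literature.NumberTheory.Sieve.polyRootCountMod ![g] p`). We prove **Mertens' first theorem for the
roots of `g`**: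

* `abs_sum_primesLE_rootCount_mul_log_div_sub_log_le_of_monic` — for `g` MONIC irreducible,
  `|∑_{p ≤ x} ρ_g(p) log p / p − log x| ≤ C_g` for all real `x ≥ 2`;
* `abs_sum_primesLE_rootCount_mul_log_div_sub_log_le` — for every irreducible `g` with
  `0 < deg g` (any leading coefficient), `|∑_{p ≤ Q} ρ_g(p) log p / p − log Q| ≤ C_g` for all
  integers `Q ≥ 2`.

## The argument

The monic case is Hardy–Wright's partial summation for Theorem 424
(`Literature.NumberTheory.LFunctions.ThetaMertens.abs_sum_div_sub_log_le`, with
`c(n) = ρ_g(n) log n` at primes and `0` elsewhere) run on the prime number theorem for the roots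
of `g`, `∑_{p ≤ x} ρ_g(p) log p = x + O(x/log² x)`
(`DegreeOnePrimes.abs_sum_primesLE_rootCount_mul_log_sub_self_le_logPow`, i.e. Landau's prime
ideal theorem for `ℚ[X]/(g)` through Dedekind–Kummer). The general case passes to the monic
integral normalization `g₁` of `g` (`g₁(cx) = c^{d-1} g(x)`, `c = lc g`), which is irreducible
(`Literature.NumberTheory.Sieve.irreducible_integralNormalization`) with `ρ_{g₁}(p) = ρ_g(p)` for every
prime `p ∤ c` (`Literature.NumberTheory.Sieve.polyRootCountMod_integralNormalization`); the finitely many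
primes `p ∣ c` change the sum by at most `∑_{p ≤ |c|} log p`.

## References

* E. Landau, *Neuer Beweis des Primzahlsatzes und Beweis des Primidealsatzes*, Math. Ann. 56
  (1903), 645–670, §§12–13, eq. (57) p. 669. [cite: LandauMathAnn1903, §§12-13 p. 669]
* G. H. Hardy, E. M. Wright, *An Introduction to the Theory of Numbers*, 6th ed., §22.6
  Theorem 424 (method). [cite: HardyWright2008, §22.6]
-/

noncomputable section

open Finset Real Polynomial

namespace Literature.NumberTheory.LFunctions.DegreeOnePrimes

open Literature.NumberTheory.Sieve

/-- **Mertens' first theorem for the roots of a monic irreducible polynomial** (real form): for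
`g ∈ ℤ[X]` monic irreducible there is `C` with `|∑_{p ≤ x} ρ_g(p) log p / p − log x| ≤ C` for all
real `x ≥ 2`, `ρ_g(p) = #{n < p : p ∣ g(n)}` — Hardy–Wright's partial summation (Theorem 424) on
the prime number theorem for the roots of `g` (Landau 1903).
[cite: LandauMathAnn1903, §§12-13 p. 669] -/
theorem abs_sum_primesLE_rootCount_mul_log_div_sub_log_le_of_monic {g : ℤ[X]} (hg : g.Monic)
    (hirr : Irreducible g) :
    ∃ C : ℝ, ∀ x : ℝ, 2 ≤ x →
      |(∑ p ∈ Nat.primesLE ⌊x⌋₊,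
          (#((range p).filter fun n : ℕ => (p : ℤ) ∣ g.eval (n : ℤ)) : ℝ) * Real.log p / p) -
        Real.log x| ≤ C := by
  obtain ⟨C, hC⟩ := abs_sum_primesLE_rootCount_mul_log_sub_self_le_logPow hg hirr 2
  set ν : ℕ → ℝ := fun p => (#((range p).filter fun n : ℕ => (p : ℤ) ∣ g.eval (n : ℤ)) : ℝ)
    with hν
  set c : ℕ → ℝ := fun n => if n.Prime then ν n * Real.log n else 0 with hc
  have hsum : ∀ (m : ℕ) (w : ℕ → ℝ),
      ∑ n ∈ Icc 0 m, (if n.Prime then w n else 0) = ∑ p ∈ Nat.primesLE m, w p := by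
    intro m w
    rw [Nat.primesLE_eq_filter_Icc_zero, sum_filter]
  have hS : ∀ t : ℝ, 2 ≤ t → |∑ n ∈ Icc 0 ⌊t⌋₊, c n - t| ≤ C * t / Real.log t ^ 2 := by
    intro t ht
    have h := hC t ht
    rw [Real.rpow_two] at h
    rwa [hc, hsum]
  obtain ⟨C', hC'⟩ := ThetaMertens.abs_sum_div_sub_log_le (c := c) (by simp [hc]) (by simp [hc])
    (ThetaMertens.measurable_comp_natFloor fun m => ∑ n ∈ Icc 0 m, c n) hS
  refine ⟨C', fun x hx => ?_⟩
  have hx' : ∑ n ∈ Icc 0 ⌊x⌋₊, c n / n = ∑ p ∈ Nat.primesLE ⌊x⌋₊, ν p * Real.log p / p := by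
    rw [← hsum]
    refine sum_congr rfl fun n _ => ?_
    simp only [hc]
    split_ifs
    · rfl
    · rw [zero_div]
  have h := hC' x hx
  rwa [hx'] at h

/-- **Mertens' first theorem for the roots of a monic irreducible polynomial** (integer form, in
terms of `Literature.NumberTheory.Sieve.polyRootCountMod`): `|∑_{p ≤ Q} ρ_g(p) log p / p − log Q| ≤ C` for all
integers `Q ≥ 2`. [cite: LandauMathAnn1903, §§12-13 p. 669] -/
theorem abs_sum_primesLE_polyRootCountMod_mul_log_div_sub_log_le_of_monic {g : ℤ[X]}
    (hg : g.Monic) (hirr : Irreducible g) :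
    ∃ C : ℝ, ∀ Q : ℕ, 2 ≤ Q →
      |(∑ p ∈ Nat.primesLE Q, (polyRootCountMod ![g] p : ℝ) * Real.log p / p) - Real.log Q| ≤
        C := by
  obtain ⟨C, hC⟩ := abs_sum_primesLE_rootCount_mul_log_div_sub_log_le_of_monic hg hirr
  refine ⟨C, fun Q hQ => ?_⟩
  have h := hC Q (by exact_mod_cast hQ)
  rw [Nat.floor_natCast] at h
  simpa only [polyRootCountMod_single] using h

/-- **Mertens' first theorem for the roots of an irreducible polynomial** (Landau 1903; the
"elementary result on the distribution of prime ideals" of Bateman–Horn 1962, p. 364, in its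
`log p / p`-weighted form): for `g ∈ ℤ[X]` irreducible with `0 < deg g` (any leading
coefficient) there is `C` with `|∑_{p ≤ Q} ρ_g(p) log p / p − log Q| ≤ C` for all integers
`Q ≥ 2`, where `ρ_g(p) = #{n < p : p ∣ g(n)} = polyRootCountMod ![g] p`. Reduction to the monic
integral normalization `g₁` (`ρ_{g₁}(p) = ρ_g(p)` for `p ∤ lc g`; the primes `p ∣ lc g` cost at
most `∑_{p ≤ |lc g|} log p`). [cite: LandauMathAnn1903, §§12-13 p. 669] -/
theorem abs_sum_primesLE_rootCount_mul_log_div_sub_log_le (g : ℤ[X]) (hirr : Irreducible g)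
    (hdeg : 0 < g.natDegree) :
    ∃ C : ℝ, ∀ Q : ℕ, 2 ≤ Q →
      |(∑ p ∈ Nat.primesLE Q, (polyRootCountMod ![g] p : ℝ) * Real.log p / p) - Real.log Q| ≤
        C := by
  set g₁ : ℤ[X] := integralNormalization g with hg₁
  obtain ⟨C, hC⟩ := abs_sum_primesLE_polyRootCountMod_mul_log_div_sub_log_le_of_monic
    (monic_integralNormalization hirr.ne_zero) (irreducible_integralNormalization hirr hdeg)
  set N : ℕ := g.leadingCoeff.natAbs with hN
  set E : ℝ := ∑ p ∈ Nat.primesLE N, Real.log p with hE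
  set ρ : ℕ → ℝ := fun p => (polyRootCountMod ![g] p : ℝ) with hρ
  set ρ₁ : ℕ → ℝ := fun p => (polyRootCountMod ![g₁] p : ℝ) with hρ₁
  have hlc : g.leadingCoeff ≠ 0 := leadingCoeff_ne_zero.mpr hirr.ne_zero
  -- at a prime `p ∤ lc g` the two root counts agree
  have hagree : ∀ p : ℕ, p.Prime → ¬ p ∣ N → ρ p = ρ₁ p := by
    intro p hp hpN
    simp only [hρ, hρ₁, hg₁]
    rw [polyRootCountMod_integralNormalization hdeg hp]
    intro hdvd
    exact hpN (Int.natCast_dvd.mp hdvd)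
  -- at every prime the difference of the terms is at most `log p`
  have hterm : ∀ p : ℕ, p.Prime →
      |ρ p * Real.log p / p - ρ₁ p * Real.log p / p| ≤ Real.log p := by
    intro p hp
    have hp0 : (0 : ℝ) < p := by exact_mod_cast hp.pos
    have hlog : 0 ≤ Real.log p := Real.log_natCast_nonneg p
    have h0 : 0 ≤ ρ p := Nat.cast_nonneg _
    have h1 : 0 ≤ ρ₁ p := Nat.cast_nonneg _
    have h2 : ρ p ≤ p := by
      simp only [hρ]
      exact_mod_cast polyRootCountMod_le ![g] p
    have h3 : ρ₁ p ≤ p := by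
      simp only [hρ₁]
      exact_mod_cast polyRootCountMod_le ![g₁] p
    have hd : |ρ p - ρ₁ p| ≤ p := by
      rw [abs_le]
      constructor <;> linarith
    rw [← sub_div, ← sub_mul, abs_div, abs_mul, abs_of_nonneg hlog, abs_of_pos hp0,
      div_le_iff₀ hp0]
    calc |ρ p - ρ₁ p| * Real.log p ≤ p * Real.log p := mul_le_mul_of_nonneg_right hd hlog
      _ = Real.log p * p := mul_comm _ _
  refine ⟨C + E, fun Q hQ => ?_⟩
  have hmain := hC Q hQ
  -- the difference of the two sums is supported on the primes dividing `lc g`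
  have hdiff : |(∑ p ∈ Nat.primesLE Q, ρ p * Real.log p / p) -
      ∑ p ∈ Nat.primesLE Q, ρ₁ p * Real.log p / p| ≤ E := by
    rw [← sum_sub_distrib]
    have h1 : ∑ p ∈ Nat.primesLE Q, (ρ p * Real.log p / p - ρ₁ p * Real.log p / p) =
        ∑ p ∈ (Nat.primesLE Q).filter (fun p => p ∣ N),
          (ρ p * Real.log p / p - ρ₁ p * Real.log p / p) := by
      rw [sum_filter_of_ne]
      intro p hp hne
      by_contra hpN
      exact hne (by rw [hagree p (Nat.prime_of_mem_primesLE hp) hpN, sub_self])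
    rw [h1]
    calc |∑ p ∈ (Nat.primesLE Q).filter (fun p => p ∣ N),
            (ρ p * Real.log p / p - ρ₁ p * Real.log p / p)|
        ≤ ∑ p ∈ (Nat.primesLE Q).filter (fun p => p ∣ N),
            |ρ p * Real.log p / p - ρ₁ p * Real.log p / p| := abs_sum_le_sum_abs _ _
      _ ≤ ∑ p ∈ (Nat.primesLE Q).filter (fun p => p ∣ N), Real.log p :=
          sum_le_sum fun p hp => hterm p (Nat.prime_of_mem_primesLE (mem_filter.mp hp).1)
      _ ≤ E := by
          refine sum_le_sum_of_subset_of_nonneg (fun p hp => ?_)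
            fun p _ _ => Real.log_natCast_nonneg p
          obtain ⟨hp, hpN⟩ := mem_filter.mp hp
          exact Nat.mem_primesLE.mpr
            ⟨Nat.le_of_dvd (Int.natAbs_pos.mpr hlc) hpN, Nat.prime_of_mem_primesLE hp⟩
  calc |(∑ p ∈ Nat.primesLE Q, ρ p * Real.log p / p) - Real.log Q|
      ≤ |(∑ p ∈ Nat.primesLE Q, ρ₁ p * Real.log p / p) - Real.log Q| +
        |(∑ p ∈ Nat.primesLE Q, ρ p * Real.log p / p) -
          ∑ p ∈ Nat.primesLE Q, ρ₁ p * Real.log p / p| := by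
        have := abs_add_le ((∑ p ∈ Nat.primesLE Q, ρ₁ p * Real.log p / p) - Real.log Q)
          ((∑ p ∈ Nat.primesLE Q, ρ p * Real.log p / p) -
            ∑ p ∈ Nat.primesLE Q, ρ₁ p * Real.log p / p)
        rwa [show (∑ p ∈ Nat.primesLE Q, ρ₁ p * Real.log p / p) - Real.log Q +
          ((∑ p ∈ Nat.primesLE Q, ρ p * Real.log p / p) -
            ∑ p ∈ Nat.primesLE Q, ρ₁ p * Real.log p / p) =
          (∑ p ∈ Nat.primesLE Q, ρ p * Real.log p / p) - Real.log Q by ring] at this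
    _ ≤ C + E := add_le_add hmain hdiff

end Literature.NumberTheory.LFunctions.DegreeOnePrimes

end
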